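import Literature.NumberTheory.GaloisRepresentations.PadicImageScalarsOfPrimeToPResidualImageProofs
import Literature.NumberTheory.EllipticCurves.MastellaZerman2026.HowardDivisibilityScalarImage
import Literature.NumberTheory.EllipticCurves.ModPImageScalarProofs
import Literature.NumberTheory.EllipticCurves.TateModuleFreeProofs
import Literature.NumberTheory.EllipticCurves.TateModuleFinrankProofs
import Literature.NumberTheory.EllipticCurves.TateModuleProjSurjectiveProofs
import Literature.NumberTheory.EllipticCurves.TateModuleContinuityProofs
import Literature.NumberTheory.EllipticCurves.FrobeniusTateModuleProofs
import Literature.NumberTheory.EllipticCurves.HeegnerPointsKolyvaginConjugation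
import Literature.NumberTheory.GaloisRepresentations.CyclotomicCharacterSurjectiveProofs
import Mathlib.NumberTheory.Padics.Hensel
import Mathlib.RingTheory.Polynomial.Cyclotomic.Roots
import HarnessLib

/-!
# Mastella–Zerman's image hypothesis "`ρ_{E,p^∞}(G_ℚ) ∋ 1 + pℤ_p`" HOLDS for `E/ℚ` with `E[p]`
# irreducible and `ρ̄_{E,p}` not surjective, `p` odd (Lombardo–Tronto 2022, Thm. 3.16 / Prop. 3.12,
# kernel form) — discharge of `MastellaZerman2026.HasPadicScalarImage`

Topic `NumberTheory/EllipticCurves`; THEOREMS ONLY (no definition, no named fact). Pure-proof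
companion of `MastellaZerman2026/HowardDivisibilityScalarImage.lean` (cell `bsd-print-x9`, seat
ty1), whose named fact `cor46_howardDivisibility_of_scalarImage` (Mastella–Zerman 2026, Cor. 4.6 =
Howard's Thm. B without surjectivity) carries the per-curve image certificate
`HasPadicScalarImage W p` : "every `a ∈ ℤ_p` with `a ≡ 1 (mod p)` acts on `T_pE` as some
`σ ∈ Γ_ℚ`" (their Assumption 2.13 (v)). This file PROVES that certificate CLASS-WIDE:

**Theorem** (`hasPadicScalarImage_of_hasIrreducibleModPGaloisRep_of_not_hasSurjectiveModNGaloisRep`).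
Let `E/ℚ` be an elliptic curve and `p` an odd prime such that `E[p]` is an irreducible
`Γ_ℚ`-module and `ρ̄_{E,p} : Γ_ℚ → Aut(E[p])` is NOT surjective. Then `ρ_{E,p^∞}(Γ_ℚ) ⊇ 1 + pℤ_p`.

This is printed: D. Lombardo, S. Tronto, *Some uniform bounds for elliptic curves over `ℚ`*,
Pacific J. Math. 320 (2022) [LombardoTronto2022] — Thm. 3.16 (non-CM `E/ℚ`: `G_{ℓ^∞} ⊇` all
scalars `≡ 1 (mod ℓ^{s_ℓ})` with `s_ℓ = 1` for `ℓ ∈ {5,7,11,13,17,37}`, `0` for `ℓ ≥ 19`, `ℓ ≠ 37`),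
whose case 3 ("`E[ℓ]` irreducible and `ℓ ∤ #G_ℓ`") is exactly the non-surjective irreducible case
(their Lemma 3.6: irreducible with `ℓ ∣ #G_ℓ` forces `G_{ℓ^∞} = GL₂(ℤ_ℓ)`), and Prop. 3.12 (`ℓ = 3`,
`E[3]` irreducible: `G_{3^∞} ⊇ ℤ_3ˣ`). The print argues shape by shape through Zywina's
classification of the images (Cor. 3.7, Prop. 3.4 (1a)/(1b), the `𝔖₄`-image at `ℓ = 13`); the
kernel proof below runs their averaging induction ONCE for every residual image of order prime to
`p` with scalar commutant (`GaloisRepresentations/PadicImageScalarsOfPrimeToPResidualImageProofs`,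
`PrimeToPScalars.exists_apply_eq_det_pow_smul_one_add`), fed with tree theorems only:

1. `p ∤ #ρ̄_{E,p}(Γ_ℚ)` — Serre 1972 Prop. 15 for an irreducible proper image with surjective
   determinant (tree `Serre1972.not_dvd_natCard_of_forall_not_le_eigenvectorStabilizer`, framed by
   `exists_frame_galoisRepTorsion_rat`); so `K = ker ρ̄_{E,p}` has index prime to `p`, and it acts
   trivially on `T_pE` modulo `p` (`exists_eq_one_add_smul_of_mem_ker`, via `T_pE/p = E[p]`:
   §2, an element of `T_pE` with zero first component is divisible by `p`).
2. Schur for `ρ̄_{E,p}` over `Γ_ℚ` (`exists_eq_smul_one_add_smul_of_forall_conj`): an endomorphism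
   of `T_pE` commuting with `Γ_ℚ` modulo `p` induces a `Γ_ℚ`-endomorphism of `E[p]`, which
   preserves the `+1`-eigenLINE of a complex conjugation (`p` odd; tree
   `RatClosure.exists_eigenvectors`, Weil pairing), so has an eigenvalue whose eigenspace is stable,
   hence everything (irreducibility) — the absolute irreducibility of an odd irreducible `ρ̄`
   (Gross 1991, Prop. 9.3; Matar–Nekovář 2019, Prop. 5.26 (3) for the statement over `K`).
3. `det ρ_{E,p} = χ_p` (Weil pairing, tree `det_galoisRepTate_eq_cyclotomicCharacter_holds`) and
   `χ_p : Γ_ℚ → ℤ_pˣ` onto (tree `GaloisRep.cyclotomicCharacter_surjective`, irreducibility of the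
   cyclotomic polynomials over `ℚ`): with a `p`-adic `m^k`-th root `a₀` of the target `a ≡ 1 (mod p)`
   (Hensel, §1; `p ∤ m`) and `χ_p(σ₀) = a₀`, step 1–2's theorem gives, for every `n`, a `σₙ ∈ Γ_ℚ`
   acting as `a` on `T_pE` modulo `pⁿ`.
4. Compactness of `Γ_ℚ` (the sets "acts as `a` on `E[pⁿ]`-components" are closed, nested,
   non-empty) produces one `σ` with `ρ_{E,p^∞}(σ) = a · 1` (§4; pattern of
   `GaloisRep.cyclotomicCharacter_surjective`).

Consequences recorded (§5): on the print-tier leaves of cell `bsd-print-x9` — `ClassX9` (`p ∈ {5,7}`,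
irreducible non-surjective) and `ClassX10b` (`p = 3`, images 3Ns/3Nn) — the MZ26 image hypothesis
is a THEOREM, so `cor46_howardDivisibility_of_scalarImage` applies there modulo its frame conditions
only (`d_K ∉ {-3,-4}`, `(Np, d_K) = 1`, `p ∤ h_K`, Heegner, good ordinary): see the leaf file
`Summits/BirchSwinnertonDyer/Rank1Residual/X9/LeafDischargeScalarImage.lean`.

HONEST FRAMING: nothing here asserts Howard's divisibility; the named fact of the sibling file is
exactly as open (typed, unproved) as before. What changed: its image certificate is no longer a
per-pair computation on the cell's leaves.

## References

* [LombardoTronto2022] D. Lombardo, S. Tronto, Pacific J. Math. 320 (2022) 133–175, §3.1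
  Prop. 3.4, Cor. 3.7; §3.3 Prop. 3.12; §3.4 Thm. 3.16 (held: S. Tronto, PhD thesis Leiden 2022,
  Ch. 2, pp. 58–68).
* [MastellaZerman2026] L. Mastella, F. Zerman, Ann. Math. Québec (2026) = arXiv:2505.08710,
  Assumption 2.13 (v), §4.1 ("This is true if for instance the representation is surjective").
* [Serre1972] J.-P. Serre, Invent. Math. 15 (1972), §2.4 Prop. 15, §5.2 (iii)–(iv).
* [GrossLMS1991] B. H. Gross, LMS LN 153 (1991), Prop. 9.3, Prop. 9.5 (1).
* [SilvermanAEC2009] J. H. Silverman, *AEC*, III.§7 (Tate module), III.§8 (Weil pairing).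
-/

set_option autoImplicit false

noncomputable section

open scoped Classical
open Polynomial

namespace Literature.NumberTheory.EllipticCurves.MastellaZerman2026

open _root_.WeierstrassCurve _root_.Field Literature.NumberTheory.EllipticCurves
  Literature.NumberTheory.GaloisRepresentations

/-! ### §1. `p`-adic roots of `1`-units (Hensel) -/

/-- An element of `ℤ_p` congruent to `1` modulo `p` is a unit. [folklore] -/
private theorem isUnit_of_dvd_sub_one' {p : ℕ} [Fact p.Prime] {a : ℤ_[p]}
    (ha : (p : ℤ_[p]) ∣ a - 1) : IsUnit a := by
  have hmem : 1 - a ∈ nonunits ℤ_[p] := by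
    rw [← IsLocalRing.mem_maximalIdeal, PadicInt.maximalIdeal_eq_span_p, Ideal.mem_span_singleton]
    have : (1 : ℤ_[p]) - a = -(a - 1) := by ring
    rw [this]
    exact (dvd_neg).mpr ha
  have h := IsLocalRing.isUnit_one_sub_self_of_mem_nonunits (1 - a) hmem
  rwa [sub_sub_cancel] at h

/-- For `a ≡ 1 (mod p)` and `p ∤ e`, `a` has an `e`-th root `b ≡ 1 (mod p)` in `ℤ_p` (Hensel's
lemma for `X^e - a` at `1`: `‖1 - a‖ < 1 = ‖e‖²`). Serre, *Cours d'arithmétique* II §3; Mathlib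
`hensels_lemma`. [folklore] -/
private theorem exists_pow_eq_of_dvd_sub_one {p : ℕ} [Fact p.Prime] {a : ℤ_[p]}
    (ha : (p : ℤ_[p]) ∣ a - 1) {e : ℕ} (he : ¬ p ∣ e) :
    ∃ b : ℤ_[p], (p : ℤ_[p]) ∣ b - 1 ∧ b ^ e = a := by
  set F : Polynomial ℤ_[p] := X ^ e - C a with hF
  have hF1 : F.aeval (1 : ℤ_[p]) = 1 - a := by simp [hF]
  have hF'1 : F.derivative.aeval (1 : ℤ_[p]) = (e : ℤ_[p]) := by
    simp [hF, derivative_X_pow]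
  have hne : ‖F.derivative.aeval (1 : ℤ_[p])‖ = 1 := by
    rw [hF'1, PadicInt.norm_natCast_eq_one_iff]
    exact (Nat.Prime.coprime_iff_not_dvd Fact.out).mpr he
  have hnorm : ‖F.aeval (1 : ℤ_[p])‖ < ‖F.derivative.aeval (1 : ℤ_[p])‖ ^ 2 := by
    rw [hne, one_pow, hF1, PadicInt.norm_lt_one_iff_dvd, show (1 : ℤ_[p]) - a = -(a - 1) by ring,
      dvd_neg]
    exact ha
  obtain ⟨z, hz, hz1, -, -⟩ := hensels_lemma hnorm
  refine ⟨z, ?_, ?_⟩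
  · rw [hne, PadicInt.norm_lt_one_iff_dvd] at hz1
    exact hz1
  · have : z ^ e - a = 0 := by simpa [hF] using hz
    exact sub_eq_zero.mp this

/-! ### §2. `T_pE / p = E[p]`: elements and endomorphisms of `T_pE` vanishing in the first component -/

section Tate

variable {A : Type*} [AddCommGroup A] {p : ℕ} [Fact p.Prime]

omit [Fact p.Prime] in
/-- `p^k · a_{n+k} = a_n` for a compatible sequence `a ∈ T_p A`. [folklore] -/
private theorem pow_smul_proj_add (a : TateModule A p) (n : ℕ) :
    ∀ k : ℕ, p ^ k • TateModule.proj p (n + k) a = TateModule.proj p n a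
  | 0 => by rw [pow_zero, one_smul, add_zero]
  | k + 1 => by
    rw [pow_succ, mul_smul, ← add_assoc, TateModule.smul_proj_succ, pow_smul_proj_add a n k]

omit [Fact p.Prime] in
/-- If `a_1 = 0` then `a_{n+1} ∈ A[p^n]`. [folklore] -/
private theorem proj_succ_mem_of_proj_one_eq_zero {a : TateModule A p}
    (ha : TateModule.proj p 1 a = 0) (n : ℕ) :
    TateModule.proj p (n + 1) a ∈ AddSubgroup.torsionBy A (p ^ n : ℕ) := by
  rw [AddSubgroup.torsionBy.nsmul_iff, add_comm, pow_smul_proj_add a 1 n, ha]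

/-- The `n`-th component of `pⁿ · v` vanishes (`(pⁿ mod pⁿ) = 0`). [folklore] -/
private theorem proj_pow_smul (v : TateModule A p) (n : ℕ) :
    TateModule.proj p n (((p : ℤ_[p]) ^ n) • v) = 0 := by
  rw [TateModule.proj_smul, map_pow, map_natCast, ← Nat.cast_pow, ZMod.natCast_self, ZMod.val_zero,
    zero_smul]

/-- **An endomorphism of `T_p A` that kills all first components is divisible by `p`**: if
`(f t)_1 = 0` for all `t`, then `f = p · U` with `(U t)_n = (f t)_{n+1}` (the sequence shifted by
one is again compatible, and `p ·` shifts back). Silverman *AEC* III.§7 (`T_ℓ/ℓT_ℓ = E[ℓ]`).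
[cite: SilvermanAEC2009, III.§7 (Prop. III.7.1 proof)] -/
theorem exists_eq_smul_of_forall_proj_one_eq_zero (f : Module.End ℤ_[p] (TateModule A p))
    (hf : ∀ t, TateModule.proj p 1 (f t) = 0) :
    ∃ U : Module.End ℤ_[p] (TateModule A p), f = (p : ℤ_[p]) • U := by
  -- the shifted sequence of `f t`
  have hval : ∀ (t : TateModule A p) (n : ℕ) (x : ℤ_[p]),
      (PadicInt.toZModPow (n + 1) x).val • TateModule.proj p (n + 1) (f t) =
        (PadicInt.toZModPow n x).val • TateModule.proj p (n + 1) (f t) := fun t n x => by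
    rw [TateModule.val_toZModPow_eq_mod p n x,
      ← AddSubgroup.torsionBy.mod_self_nsmul' _ (proj_succ_mem_of_proj_one_eq_zero (hf t) n)]
  let U : Module.End ℤ_[p] (TateModule A p) :=
    { toFun := fun t => TateModule.mk (fun n => TateModule.proj p (n + 1) (f t))
        (fun n => AddSubgroup.torsionBy.nsmul_iff.mp (proj_succ_mem_of_proj_one_eq_zero (hf t) n))
        (fun n => TateModule.smul_proj_succ (n + 1) (f t))
      map_add' := fun s t => TateModule.ext fun n => by
        simp only [map_add, TateModule.proj_mk]
      map_smul' := fun x t => TateModule.ext fun n => by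
        simp only [map_smul, TateModule.proj_mk, RingHom.id_apply, TateModule.proj_smul]
        exact hval t n x }
  have hU : ∀ (t : TateModule A p) (n : ℕ),
      TateModule.proj p n (U t) = TateModule.proj p (n + 1) (f t) := fun _ _ => rfl
  refine ⟨U, LinearMap.ext fun t => TateModule.ext fun n => ?_⟩
  rw [LinearMap.smul_apply, TateModule.proj_smul, hU, map_natCast, ZMod.val_natCast,
    ← AddSubgroup.torsionBy.mod_self_nsmul' _ (proj_succ_mem_of_proj_one_eq_zero (hf t) n),
    TateModule.smul_proj_succ]

/-- Element version: `t ∈ T_p A` with `t_1 = 0` is `p · u`. [cite: SilvermanAEC2009, III.§7] -/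
theorem exists_eq_smul_of_proj_one_eq_zero (t : TateModule A p) (ht : TateModule.proj p 1 t = 0) :
    ∃ u : TateModule A p, t = (p : ℤ_[p]) • u := by
  -- the shifted sequence `u_n = t_{n+1}`
  have hval : ∀ (n : ℕ), (p % p ^ n) • TateModule.proj p (n + 1) t =
      p • TateModule.proj p (n + 1) t := fun n =>
    (AddSubgroup.torsionBy.mod_self_nsmul' _ (proj_succ_mem_of_proj_one_eq_zero ht n)).symm
  refine ⟨TateModule.mk (fun n => TateModule.proj p (n + 1) t)
    (fun n => AddSubgroup.torsionBy.nsmul_iff.mp (proj_succ_mem_of_proj_one_eq_zero ht n))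
    (fun n => TateModule.smul_proj_succ (n + 1) t), TateModule.ext fun n => ?_⟩
  rw [TateModule.proj_smul, TateModule.proj_mk, map_natCast, ZMod.val_natCast, hval,
    TateModule.smul_proj_succ]

end Tate

/-! ### §3. The two residual inputs on `T_pE`: `ker ρ̄` acts trivially mod `p`; Schur mod `p` -/

section Residual

variable (W : WeierstrassCurve ℚ) [W.IsElliptic] (p : ℕ) [Fact p.Prime]

omit [W.IsElliptic] [Fact p.Prime] in
/-- The first component of `t ∈ T_pE` is a point of `E[p]`. [folklore] -/
private theorem proj_one_mem (t : W.tateModule p) : TateModule.proj p 1 t ∈ geomTorsion W p := by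
  have h := TateModule.proj_mem_torsionBy 1 t
  rwa [pow_one] at h

/-- Every point of `E[p]` is the first component of some `t ∈ T_pE` (`[p]` is onto `E(ℚ̄)`; tree
`proj_surjective_of_isAlgClosed_holds`). [cite: SilvermanAEC2009, III.§7] -/
private theorem exists_proj_one_eq (P : geomTorsion W p) :
    ∃ t : W.tateModule p, TateModule.proj p 1 t = (P : geomPoints W) :=
  proj_surjective_of_isAlgClosed_holds W p 1 (by rw [pow_one]; exact P.2)

omit [W.IsElliptic] in
/-- **`ker ρ̄_{E,p}` acts trivially on `T_pE` modulo `p`**: if `k` fixes `E[p]` pointwise then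
`ρ_{E,p^∞}(k) = 1 + p·U`. [cite: SilvermanAEC2009, III.§7 (`T_ℓ/ℓ T_ℓ ≅ E[ℓ]`)] -/
theorem exists_eq_one_add_smul_of_mem_ker {k : absoluteGaloisGroup ℚ}
    (hk : k ∈ (galoisRepTorsion W p).ker) :
    ∃ U : Module.End ℤ_[p] (W.tateModule p), galoisRepTate W p k = 1 + (p : ℤ_[p]) • U := by
  have hfix : ∀ P : geomTorsion W p, k • (P : geomPoints W) = P := fun P => by
    have h := congrArg (fun φ : Multiplicative (AddAut (geomTorsion W p)) => (φ.toAdd P : geomPoints W))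
      (MonoidHom.mem_ker.mp hk)
    simpa using h
  obtain ⟨U, hU⟩ := exists_eq_smul_of_forall_proj_one_eq_zero (galoisRepTate W p k - 1) fun t => by
    rw [LinearMap.sub_apply, map_sub, galoisRepTate_apply_apply,
      TateModule.proj_smul_of_distribMulAction, Module.End.one_apply, sub_eq_zero]
    exact hfix ⟨_, proj_one_mem W p t⟩
  exact ⟨U, by rw [← hU, add_sub_cancel]⟩

omit [W.IsElliptic] in
/-- `(p · v)_1 = 0`. [folklore] -/
private theorem proj_one_p_smul (v : W.tateModule p) :
    TateModule.proj p 1 ((p : ℤ_[p]) • v) = 0 := by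
  have h := proj_pow_smul v 1
  rwa [pow_one] at h

/-- **The `+1`-eigenspace of complex conjugation on `E[p]` is the line through `e₊`** (`p` odd):
if `c₀ e₊ = e₊ ≠ 0` and some `e₋ ≠ 0` has `c₀ e₋ = -e₋`, every `c₀`-fixed `P` is a multiple of
`e₊` (else `⟨e₊, P⟩ = E[p] ≅ (ℤ/p)²`, so `c₀ = 1` and `2e₋ = 0`). Gross 1991, Prop. 9.5 (1):
`E_p^± ≃ ℤ/pℤ`. (Same proof as the `Summits`-side lemma of cell `bsd-potss`; Literature may not
import it.) [cite: GrossLMS1991, Prop. 9.5 (1)] -/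
theorem mem_zmultiples_of_smul_eq (hp2 : p ≠ 2)
    {c₀ : absoluteGaloisGroup ℚ} {ePlus eMinus : geomTorsion W p} (hPlus0 : ePlus ≠ 0)
    (hPlus : c₀ • ePlus = ePlus) (hMinus0 : eMinus ≠ 0) (hMinus : c₀ • eMinus = -eMinus)
    {P : geomTorsion W p} (hP : c₀ • P = P) : P ∈ AddSubgroup.zmultiples ePlus := by
  have hp : p.Prime := Fact.out
  have hcard : Nat.card (geomTorsion W p) = p ^ 2 :=
    card_torsionPoints_eq_sq_holds W (AlgebraicClosure ℚ) (n := p) (Nat.cast_ne_zero.mpr hp.ne_zero)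
  haveI : Finite (geomTorsion W p) :=
    Nat.finite_of_card_ne_zero (by rw [hcard]; exact pow_ne_zero _ hp.ne_zero)
  have hkill : ∀ Q : geomTorsion W p, (p : ℤ) • Q = 0 := fun Q ↦ Subtype.ext (by
    rw [AddSubgroupClass.coe_zsmul, ZeroMemClass.coe_zero]
    exact (mem_geomTorsion_iff W _ (Q : geomPoints W)).mp Q.2)
  by_contra hPL
  have hLcard : Nat.card (AddSubgroup.zmultiples ePlus) = p := by
    rw [Nat.card_zmultiples]
    exact addOrderOf_eq_prime (by rw [← natCast_zsmul]; exact hkill ePlus) hPlus0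
  have hLL' : AddSubgroup.zmultiples ePlus ≤ AddSubgroup.closure {ePlus, P} := by
    rw [AddSubgroup.zmultiples_le]
    exact AddSubgroup.subset_closure (Set.mem_insert _ _)
  have hPL' : P ∈ AddSubgroup.closure {ePlus, P} :=
    AddSubgroup.subset_closure (Set.mem_insert_of_mem _ (Set.mem_singleton _))
  have hL'top : AddSubgroup.closure {ePlus, P} = ⊤ := by
    have hdvd : Nat.card (AddSubgroup.closure {ePlus, P}) ∣ p ^ 2 := by
      rw [← hcard]; exact AddSubgroup.card_addSubgroup_dvd_card _
    have hdvd' : p ∣ Nat.card (AddSubgroup.closure {ePlus, P}) := by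
      have h := AddSubgroup.card_dvd_of_le hLL'
      rwa [hLcard] at h
    obtain ⟨k, hk, hkeq⟩ := (Nat.dvd_prime_pow hp).mp hdvd
    have hk1 : k ≠ 0 := by
      rintro rfl
      rw [hkeq, pow_zero, Nat.dvd_one] at hdvd'
      exact hp.one_lt.ne' hdvd'
    have hk2 : k ≠ 1 := by
      rintro rfl
      rw [pow_one] at hkeq
      have : AddSubgroup.zmultiples ePlus = AddSubgroup.closure {ePlus, P} :=
        AddSubgroup.eq_of_le_of_card_ge hLL' (by rw [hLcard, hkeq])
      exact hPL (this ▸ hPL')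
    have hk' : k = 2 := by omega
    exact AddSubgroup.eq_top_of_card_eq _ (by rw [hkeq, hk', hcard])
  have htriv : ∀ Q : geomTorsion W p, c₀ • Q = Q := by
    intro Q
    have hQ : Q ∈ AddSubgroup.closure {ePlus, P} := by rw [hL'top]; trivial
    refine AddSubgroup.closure_induction (fun x hx ↦ ?_) (smul_zero _) (fun x y _ _ hx hy ↦ ?_)
      (fun x _ hx ↦ ?_) hQ
    · rcases hx with rfl | rfl
      · exact hPlus
      · exact hP
    · rw [smul_add, hx, hy]
    · rw [smul_neg, hx]
  have h2 : (2 : ℤ) • eMinus = 0 := by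
    have := htriv eMinus
    rw [hMinus] at this
    rw [two_smul]
    exact neg_eq_iff_add_eq_zero.mp this
  apply hMinus0
  obtain ⟨c, hc⟩ := hp.odd_of_ne_two hp2
  have : eMinus = (p : ℤ) • eMinus - (c : ℤ) • ((2 : ℤ) • eMinus) := by
    rw [smul_smul, ← sub_smul, show (p : ℤ) - c * 2 = 1 by rw [hc]; push_cast; ring, one_smul]
  rw [this, h2, smul_zero, sub_zero, hkill]

/-- **Schur for `ρ̄_{E,p}` over `Γ_ℚ`, read on `T_pE` (`p` odd, `E[p]` irreducible)**: an
endomorphism `S` of `T_pE` with `ρ(g) S ρ(g)⁻¹ ≡ S (mod p)` for all `g ∈ Γ_ℚ` is a scalar modulo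
`p`: `S = z·1 + p·U`. The induced `Γ_ℚ`-endomorphism of `E[p] = T_pE/p` maps the `c₀`-fixed LINE
`𝔽_p e₊` (`mem_zmultiples_of_smul_eq`) to itself, so `S̄ e₊ = k e₊`; `{P : S̄ P = kP}` is a non-zero
stable subgroup, hence `E[p]`. (Absolute irreducibility of an odd irreducible `ρ̄`: Gross 1991
Prop. 9.3; Matar–Nekovář 2019 Prop. 5.26 (3) prints the quadratic-base-field version.)
[cite: GrossLMS1991, Prop. 9.3 (proof) and Prop. 9.5 (1)] -/
theorem exists_eq_smul_one_add_smul_of_forall_conj (hp2 : p ≠ 2)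
    (hirr : W.HasIrreducibleModPGaloisRep p) (S : Module.End ℤ_[p] (W.tateModule p))
    (hS : ∀ g : absoluteGaloisGroup ℚ, ∃ D : Module.End ℤ_[p] (W.tateModule p),
      galoisRepTate W p g * S * galoisRepTate W p g⁻¹ = S + (p : ℤ_[p]) • D) :
    ∃ (z : ℤ_[p]) (U : Module.End ℤ_[p] (W.tateModule p)), S = z • 1 + (p : ℤ_[p]) • U := by
  have hp : p.Prime := Fact.out
  -- Step 1: `S` commutes with `Γ_ℚ` on first components
  have hcomm : ∀ (g : absoluteGaloisGroup ℚ) (t : W.tateModule p),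
      TateModule.proj p 1 (S (g • t)) = g • TateModule.proj p 1 (S t) := by
    intro g t
    obtain ⟨D, hD⟩ := hS g
    have h := congrArg (fun φ : Module.End ℤ_[p] (W.tateModule p) => TateModule.proj p 1 (φ (g • t))) hD
    simp only [Module.End.mul_apply, galoisRepTate_apply_apply, LinearMap.add_apply,
      LinearMap.smul_apply, map_add, inv_smul_smul, proj_one_p_smul, add_zero] at h
    rw [← h, TateModule.proj_smul_of_distribMulAction]
  -- Step 2: the first component of `S t` depends only on that of `t`
  have hdep : ∀ t t' : W.tateModule p, TateModule.proj p 1 t = TateModule.proj p 1 t' →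
      TateModule.proj p 1 (S t) = TateModule.proj p 1 (S t') := by
    intro t t' h
    obtain ⟨u, hu⟩ := exists_eq_smul_of_proj_one_eq_zero (t - t') (by rw [map_sub, h, sub_self])
    rw [← sub_eq_zero, ← map_sub, ← map_sub, hu, map_smul, proj_one_p_smul]
  -- Step 3: complex conjugation and its eigenvectors on `E[p]`
  obtain ⟨c₀, hc₀⟩ := exists_isComplexConjugation (Rat.castHom ℝ)
  obtain ⟨⟨ePlus, hePlus0, hePlus⟩, ⟨eMinus, heMinus0, heMinus⟩⟩ :=
    RatClosure.exists_eigenvectors W hc₀ (W.exists_weilPairing_holds p) hp2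
  -- Step 4: `S̄ e₊` is `c₀`-fixed, hence a multiple of `e₊`
  obtain ⟨tPlus, htPlus⟩ := exists_proj_one_eq W p ePlus
  set fPlus : geomTorsion W p := ⟨TateModule.proj p 1 (S tPlus), proj_one_mem W p _⟩ with hfPlus
  have hfix : c₀ • fPlus = fPlus := by
    apply Subtype.ext
    rw [AddSubgroup.torsionBy.coe_smul, hfPlus, ← hcomm]
    refine hdep _ _ ?_
    rw [TateModule.proj_smul_of_distribMulAction, htPlus, ← AddSubgroup.torsionBy.coe_smul, hePlus]
  obtain ⟨k', hk'⟩ := AddSubgroup.mem_zmultiples_iff.mp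
    (mem_zmultiples_of_smul_eq W p hp2 hePlus0 hePlus heMinus0 heMinus hfix)
  -- a natural-number representative `k` of `k'` modulo `p`
  have hkillP : ∀ Q : geomTorsion W p, (p : ℤ) • Q = 0 := fun Q ↦ Subtype.ext (by
    rw [AddSubgroupClass.coe_zsmul, ZeroMemClass.coe_zero]
    exact (mem_geomTorsion_iff W _ (Q : geomPoints W)).mp Q.2)
  set k : ℕ := (k' % p).toNat with hk
  have hkk' : (k : ℤ) • ePlus = k' • ePlus := by
    rw [hk, Int.toNat_of_nonneg (Int.emod_nonneg _ (by exact_mod_cast hp.ne_zero)),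
      Int.emod_def, sub_smul, mul_smul, hkillP, sub_zero]
  have hkPlus : TateModule.proj p 1 (S tPlus) = k • (ePlus : geomPoints W) := by
    have h : ((k' • ePlus : geomTorsion W p) : geomPoints W) = fPlus := congrArg Subtype.val hk'
    rw [← hkk', natCast_zsmul, AddSubgroupClass.coe_nsmul] at h
    rw [h, hfPlus]
  -- Step 5: the subgroup where `S̄ = k` is stable and contains `e₊`, hence everything
  set H : AddSubgroup (geomTorsion W p) :=
    { carrier := {P | ∀ t : W.tateModule p, TateModule.proj p 1 t = (P : geomPoints W) →
        TateModule.proj p 1 (S t) = k • (P : geomPoints W)}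
      zero_mem' := fun t ht => by
        rw [ZeroMemClass.coe_zero, smul_zero, hdep t 0 (by rw [ht, ZeroMemClass.coe_zero, map_zero]),
          map_zero, map_zero]
      add_mem' := fun {P Q} hP hQ t ht => by
        obtain ⟨tP, htP⟩ := exists_proj_one_eq W p P
        obtain ⟨tQ, htQ⟩ := exists_proj_one_eq W p Q
        rw [hdep t (tP + tQ) (by rw [ht, map_add, htP, htQ, AddSubgroup.coe_add]), map_add, map_add,
          hP tP htP, hQ tQ htQ, AddSubgroup.coe_add, smul_add]
      neg_mem' := fun {P} hP t ht => by
        obtain ⟨tP, htP⟩ := exists_proj_one_eq W p P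
        rw [hdep t (-tP) (by rw [ht, map_neg, htP, AddSubgroup.coe_neg]), map_neg, map_neg,
          hP tP htP, AddSubgroup.coe_neg, smul_neg] } with hH
  have hHmem : ∀ P, P ∈ H ↔ ∀ t : W.tateModule p, TateModule.proj p 1 t = (P : geomPoints W) →
      TateModule.proj p 1 (S t) = k • (P : geomPoints W) := fun _ => Iff.rfl
  have hHstab : ∀ σ : absoluteGaloisGroup ℚ, ∀ P ∈ H, σ • P ∈ H := by
    intro σ P hPH t ht
    have ht' : TateModule.proj p 1 (σ⁻¹ • t) = (P : geomPoints W) := by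
      rw [TateModule.proj_smul_of_distribMulAction, ht, AddSubgroup.torsionBy.coe_smul, inv_smul_smul]
    have h := hcomm σ (σ⁻¹ • t)
    rw [smul_inv_smul] at h
    rw [h, hPH _ ht', AddSubgroup.torsionBy.coe_smul, smul_comm]
  have hPlusH : ePlus ∈ H := fun t ht => by rw [hdep t tPlus (by rw [ht, htPlus]), hkPlus]
  have hHtop : H = ⊤ := by
    rcases hirr H hHstab with h | h
    · exact absurd ((AddSubgroup.mem_bot).mp (h ▸ hPlusH)) hePlus0
    · exact h
  -- Step 6: `S - k·1` kills first components, hence is divisible by `p`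
  have hall : ∀ t : W.tateModule p, TateModule.proj p 1 (S t) = k • TateModule.proj p 1 t := by
    intro t
    have ht : (⟨TateModule.proj p 1 t, proj_one_mem W p t⟩ : geomTorsion W p) ∈ H := by
      rw [hHtop]; trivial
    exact ht t rfl
  obtain ⟨U, hU⟩ := exists_eq_smul_of_forall_proj_one_eq_zero (S - (k : ℤ_[p]) • 1) fun t => by
    rw [LinearMap.sub_apply, map_sub, LinearMap.smul_apply, Module.End.one_apply,
      TateModule.proj_smul, map_natCast, ZMod.val_natCast, pow_one,
      ← AddSubgroup.torsionBy.mod_self_nsmul' _ (proj_one_mem W p t), hall, sub_self]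
  exact ⟨k, U, by rw [← hU, add_sub_cancel]⟩

/-- **`[Γ_ℚ : ker ρ̄_{E,p}]` is prime to `p`** when `E[p]` is irreducible and `ρ̄_{E,p}` is not
surjective: the image is a proper subgroup of `GL₂(𝔽_p)` with surjective determinant and no
common eigenvector, so has order prime to `p` (Serre 1972, Prop. 15; tree theorem of
`SmallImageScalarGL2FpProofs` / `TransvectionCriterionGL2FpProofs`).
[cite: Serre1972, §2.4 Prop. 15 and §5.2 (iii)] -/
theorem not_dvd_index_ker_galoisRepTorsion (hirr : W.HasIrreducibleModPGaloisRep p)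
    (hns : ¬ W.HasSurjectiveModNGaloisRep p) :
    ¬ p ∣ (galoisRepTorsion W p).ker.index := by
  obtain ⟨e, Φ, he, -, -, -, -⟩ := exists_frame_galoisRepTorsion_rat W p
  set G : Subgroup (GL (Fin 2) (ZMod p)) := (galoisRepTorsion W p).range.map Φ.toMonoidHom with hG
  have hGtop : G ≠ ⊤ := fun h => hns ((map_range_galoisRepTorsion_eq_top_iff W p Φ).mp h)
  have hdetG : ∀ u : (ZMod p)ˣ, ∃ g ∈ G, Matrix.GeneralLinearGroup.det g = u :=
    exists_mem_map_range_det_eq W p Φ e he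
  have hirrG : ∀ (v : Fin 2 → ZMod p) (hv : v ≠ 0), ¬ G ≤ eigenvectorStabilizer v hv :=
    fun v hv => not_le_eigenvectorStabilizer_of_hasIrreducibleModPGaloisRep W p Φ e he hirr hv
  have hcard : ¬ p ∣ Nat.card G :=
    Serre1972.not_dvd_natCard_of_forall_not_le_eigenvectorStabilizer G hdetG hGtop hirrG
  rwa [Subgroup.index_ker, ← Subgroup.card_map_of_injective (f := Φ.toMonoidHom) Φ.injective]

end Residual

/-! ### §4. The theorem -/

/-- **Lombardo–Tronto 2022, Thm. 3.16 (case 3) / Prop. 3.12, kernel form; = the Mastella–Zerman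
image hypothesis**: for an elliptic curve `E/ℚ` and an odd prime `p` with `E[p]` irreducible and
`ρ̄_{E,p}` NOT surjective, the `p`-adic image `ρ_{E,p^∞}(Γ_ℚ) ⊆ Aut(T_pE)` contains every scalar
`a ≡ 1 (mod p)`, i.e. `MastellaZerman2026.HasPadicScalarImage W p`. Proof: §3 feeds
`PrimeToPScalars.exists_apply_eq_det_pow_smul_one_add` (`K = ker ρ̄`, index `m` prime to `p`;
Schur mod `p`), with `σ₀` of cyclotomic character `a^{1/m^{n+1}}` (Hensel; `det ρ = χ_p` onto), giving
`σₙ` acting as `a` modulo `p^{n+1}` for every `n`; compactness of `Γ_ℚ` gives `σ` with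
`ρ(σ) = a·1`. [cite: LombardoTronto2022, Thm. 3.16 and Prop. 3.12 (with Prop. 3.4, Cor. 3.7)]
[cite: MastellaZerman2026, Assumption 2.13 (v), §4.1] -/
theorem hasPadicScalarImage_of_hasIrreducibleModPGaloisRep_of_not_hasSurjectiveModNGaloisRep
    (W : WeierstrassCurve ℚ) [W.IsElliptic] (p : ℕ) [Fact p.Prime] (hp2 : p ≠ 2)
    (hirr : W.HasIrreducibleModPGaloisRep p) (hns : ¬ W.HasSurjectiveModNGaloisRep p) :
    HasPadicScalarImage W p := by
  have hp : p.Prime := Fact.out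
  intro a ha
  -- the inputs of the abstract theorem
  haveI : Module.Free ℤ_[p] (W.tateModule p) := module_free_tateModule_holds W p
  haveI : Module.Finite ℤ_[p] (W.tateModule p) := module_finite_tateModule_holds W p
  have hT : Module.finrank ℤ_[p] (W.tateModule p) = 2 :=
    finrank_tateModule_eq_two_holds W p (Nat.cast_ne_zero.mpr hp.ne_zero)
  set K : Subgroup (absoluteGaloisGroup ℚ) := (galoisRepTorsion W p).ker with hKdef
  have hindex : ¬ p ∣ K.index := not_dvd_index_ker_galoisRepTorsion W p hirr hns
  have hK : ∀ k ∈ K, ∃ U : Module.End ℤ_[p] (W.tateModule p),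
      galoisRepTate W p k = 1 + (p : ℤ_[p]) • U := fun k hk =>
    exists_eq_one_add_smul_of_mem_ker W p hk
  have hC := exists_eq_smul_one_add_smul_of_forall_conj W p hp2 hirr
  -- level-`p^{n+1}` approximations
  have hlevel : ∀ n : ℕ, ∃ (σ : absoluteGaloisGroup ℚ) (V : Module.End ℤ_[p] (W.tateModule p)),
      galoisRepTate W p σ = a • 1 + ((p : ℤ_[p]) ^ (n + 1)) • V := by
    intro n
    have hm : ¬ p ∣ K.index ^ (n + 1) := fun h => hindex (hp.dvd_of_dvd_pow h)
    obtain ⟨b, hb1, hba⟩ := exists_pow_eq_of_dvd_sub_one ha hm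
    obtain ⟨u, hu⟩ := isUnit_of_dvd_sub_one' hb1
    obtain ⟨σ₀, hσ₀⟩ := GaloisRep.cyclotomicCharacter_surjective ℚ p
      (fun n hn => cyclotomic.irreducible_rat hn) u
    have hdet : LinearMap.det (galoisRepTate W p σ₀) = b := by
      rw [det_galoisRepTate_eq_cyclotomicCharacter_holds W p (Nat.cast_ne_zero.mpr hp.ne_zero) σ₀,
        hσ₀, hu]
    obtain ⟨σ, V, hσ⟩ := PrimeToPScalars.exists_apply_eq_det_pow_smul_one_add hT (galoisRepTate W p)
      K hindex hK hC σ₀ n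
    exact ⟨σ, V, by rw [hσ, hdet, hba]⟩
  -- compactness
  haveI : ContinuousSMul (absoluteGaloisGroup ℚ) (geomPoints W) := continuousSMul_geomPoints' W
  let Z : ℕ → Set (absoluteGaloisGroup ℚ) := fun n =>
    {σ | ∀ t : W.tateModule p, TateModule.proj p (n + 1) (σ • t) =
      (PadicInt.toZModPow (n + 1) a).val • TateModule.proj p (n + 1) t}
  have hZclosed : ∀ n, IsClosed (Z n) := by
    intro n
    have : Z n = ⋂ t : W.tateModule p, (fun σ : absoluteGaloisGroup ℚ => σ • TateModule.proj p (n + 1) t) ⁻¹'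
        {(PadicInt.toZModPow (n + 1) a).val • TateModule.proj p (n + 1) t} := by
      ext σ
      simp only [Set.mem_setOf_eq, Set.mem_iInter, Set.mem_preimage, Set.mem_singleton_iff,
        TateModule.proj_smul_of_distribMulAction, Z]
    rw [this]
    exact isClosed_iInter fun t =>
      (isClosed_discrete _).preimage (continuous_id.smul continuous_const)
  have hZanti : ∀ n, Z (n + 1) ⊆ Z n := by
    intro n σ hσ t
    have h := hσ t
    rw [TateModule.proj_smul_of_distribMulAction] at h ⊢
    rw [← TateModule.smul_proj_succ (n + 1) t, smul_comm σ p, h,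
      smul_comm p (PadicInt.toZModPow (n + 1 + 1) a).val, TateModule.smul_proj_succ,
      AddSubgroup.torsionBy.mod_self_nsmul' _ (TateModule.proj_mem_torsionBy (n + 1) t),
      ← TateModule.val_toZModPow_eq_mod]
  have hZne : ∀ n, (Z n).Nonempty := by
    intro n
    obtain ⟨σ, V, hσ⟩ := hlevel n
    refine ⟨σ, fun t => ?_⟩
    have h := congrArg (fun φ : Module.End ℤ_[p] (W.tateModule p) => TateModule.proj p (n + 1) (φ t)) hσ
    simp only [galoisRepTate_apply_apply, LinearMap.add_apply, LinearMap.smul_apply,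
      Module.End.one_apply, map_add, proj_pow_smul, add_zero] at h
    rw [TateModule.proj_smul] at h
    exact h
  obtain ⟨σ, hσ⟩ := IsCompact.nonempty_iInter_of_sequence_nonempty_isCompact_isClosed Z hZanti
    hZne (hZclosed 0).isCompact hZclosed
  rw [Set.mem_iInter] at hσ
  refine ⟨σ, LinearMap.ext fun t => TateModule.ext fun n => ?_⟩
  cases n with
  | zero =>
    have h0 : ∀ x : W.tateModule p, TateModule.proj p 0 x = 0 := fun x => by
      have h := TateModule.pow_smul_proj 0 x
      rwa [pow_zero, one_smul] at h
    rw [h0, h0]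
  | succ n =>
    rw [galoisRepTate_apply_apply, LinearMap.smul_apply, Module.End.one_apply, TateModule.proj_smul]
    exact hσ n t

end Literature.NumberTheory.EllipticCurves.MastellaZerman2026

end
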